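import Summits.CriticalPhenomena.PercolationContinuityZ3.Theorems.PercNearOneGluingNoHeavyQuantIndepBlobMassRow
import HarnessLib

/-!
# QUANT lane R8, FAR for independent blobs: the FLOOR-RESOLVED block-star row —
# `(1 + q)·j < EW ⟹ P(W ≤ j) ≤ 1 − q` by Markov when the total weight is `≤ 2j` (every floor `q ≥ 0`), hence, together with the
# lane's MASS ROW (`IndepBlob.massRow`: total weight `> 2j`, every gate `≥ 1/2`), for EVERY block-star at heavy floors

builds on p205010 (kernel theorem, internal audit signed; external expert review pending)

Support file (`--supports stmt-CriticalPhenomena-4575`), QUANT lane typer seat prim-quant-stmt (gen 37), rung R8 of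
`run/shared/lean/prim/quant/LADDER.md`; memo `run/shared/lean/prim/quant/prim-quant-stmt-g37/FLOORROW-G37.md`.

THE TARGET.  Typer g36's floor-resolved tree row (`LawDec.TreeBuiltRowFloor`, `…QuantTreeRowFloorThreshold.lean`, threshold
`(1 + x)·j`, kernel-sharp at every floor) specialised to DEPTH-ONE BLOCK-STARS — independent Bernoulli gates `p k ∈ [q, 1]` in
front of glued blocks of (real, nonnegative) weight `a k`, `W = ∑_{k open} a k` — reads: `(1 + q)·j < EW ⟹ P(W ≤ j) ≤ 1 − q`.
By typer g36's block-star extremality census (BSE, THRESHOLD-G36 §7: 0 failures in 1 200 grid cells and 4 000 targeted forests) the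
block-stars are the conjectured extremisers of the whole tree row, so this is the conjecturally binding case.  The lane's kernel
block-star row `IndepBlob.far_indepBlob_min` has the weaker hypothesis `2j < EW`.

THIS FILE (standard axioms, no sorries):
* `IndepBlob.sum_sub_level_mul_smallBall_le` — Markov's inequality for the CLOSED weight `∑ a − W ≥ 0`:
  `(∑ a − j)·P(W ≤ j) ≤ ∑ a − EW` (every gate vector in `[0,1]`, every real `j`).
* `IndepBlob.floorRow_markov` — EVERY floor `q ≥ 0`, total weight `∑ a ≤ 2j`: `(1 + q)·j < EW ⟹ P(W ≤ j) ≤ 1 − q`, because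
  `∑ a − (1+q) j ≤ (1 − q)(∑ a − j)` exactly when `q·∑ a ≤ 2q·j`.  The two-block extremal family of
  `LawDec.treeBuiltRowFloor_threshold_sharp` (two `j`-blocks behind gates `1⁻` and `q`) has `∑ a = 2j`: the threshold `(1+q)·j` is
  sharp INSIDE this regime, at every floor.
* `IndepBlob.floorRow_indepBlob_min_heavy` — at heavy floors (least gate `p y ≥ 1/2`) the floor-resolved block-star row
  `(1 + p y)·j < EW ⟹ P(W ≤ j) ≤ 1 − p y` holds for EVERY block-star: `∑ a ≤ 2j` is `floorRow_markov`, and `∑ a > 2j` is the lane's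
  MASS ROW `IndepBlob.massRow` (census-1 g14, `…QuantIndepBlobMassRow.lean`: Hall–Harris transport, no mean hypothesis at all).
  Sharp on both sides: two `j`-blocks at `(1⁻, p y)` (Markov side) and three `j`-blocks at gate `1/2` (transport side, `P(W ≤ j) = 1/2`).
WHAT REMAINS OPEN (honest): light floors `q < 1/2` with `∑ a > 2j`.  There the conclusion `P(W ≤ j) ≤ 1 − min p` is FALSE without the
mean (three units at gate `2/5`, `j = 1`: `0.648 > 0.6`, docstring of `…QuantIndepBlobMassRow.lean`) and the floor-resolved row needs
a new argument exact at three `j`-blocks at gate `1/2`; numerically the infimum of the slack `P(W > j) − q` over `∑ a > 2j` at light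
floor `q` is `q(1−q)(1−2q) > 0`, attained at three `j`-blocks behind gates `(1−q, q, q)` (typer g37, explore/light_opt.py, exact
re-check explore/fbr_check.py: 0 violations in 59 274 random exact instances at all floors).  Every forest of depth `≥ 2` with more
than `2j` relays is open as well (the law-level Markov half `M ≤ 2j` is `LawDec.treeBuiltRowFloor_of_top_le_two_mul` in
`…QuantTreeRowFloorMarkov.lean`).  `LawDec.TreeBuiltRowFloor`, `Quant.FarTreeRow` stay OPEN; the RATE class log\* and the honest
sentence of `run/shared/lean/prim/quant/README.md` are unchanged.  Prior art searched (typer g37, 2026-08-25; corpus fts + vec,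
galaxy `star all`): small-deviation / anti-concentration bounds for weighted Bernoulli sums (Feige 2006, Paley–Zygmund, Hoeffding
1956, Jogdeo–Samuels 1968) — none has the gate-wise constant `min p` at the threshold `(1 + min p)·j`; recorded as [this work].
The gluing rows served [cite: KozmaNitzan2024, Conjecture 3 (p. 15)]; product measure [cite: Grimmett1999, §1.3 p. 10].
-/

namespace Summit.CriticalPhenomena.PercolationContinuityZ3.Theorems

namespace Quant

namespace IndepBlob

open Finset

variable {ι : Type*} [Fintype ι] [DecidableEq ι]

/-- **Markov for the closed weight.**  For gates `0 ≤ p i ≤ 1`, weights `a i ≥ 0` and any real `j`: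
`(∑ a − j) · P(W ≤ j) ≤ ∑ a − EW` — the closed weight `∑ a − W ≥ 0` is at least `∑ a − j` on `{W ≤ j}`. [this work] -/
theorem sum_sub_level_mul_smallBall_le (p a : ι → ℝ) (hp0 : ∀ i, 0 ≤ p i) (hp1 : ∀ i, p i ≤ 1) (ha : ∀ i, 0 ≤ a i) (j : ℝ) :
    (∑ i, a i - j) * ∑ W ∈ (Finset.univ : Finset (Finset ι)).filter (fun W => ∑ i ∈ W, a i ≤ j),
        (∏ k, if k ∈ W then p k else 1 - p k) ≤ ∑ i, a i - ∑ i, a i * p i := by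
  have hw0 : ∀ W, 0 ≤ (∏ k, if k ∈ W then p k else 1 - p k) := bernoulliWeight_nonneg hp0 hp1
  have hsub : ∀ W : Finset ι, ∑ i ∈ W, a i ≤ ∑ i, a i :=
    fun W => Finset.sum_le_sum_of_subset_of_nonneg (Finset.subset_univ W) fun i _ _ => ha i
  -- `∑ a − EW = ∑_W w(W) (∑ a − a(W))`
  have hrhs : ∑ i, a i - ∑ i, a i * p i =
      ∑ W : Finset ι, (∏ k, if k ∈ W then p k else 1 - p k) * (∑ i, a i - ∑ i ∈ W, a i) := by
    have e : ∀ W : Finset ι, (∏ k, if k ∈ W then p k else 1 - p k) * (∑ i, a i - ∑ i ∈ W, a i) =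
        (∏ k, if k ∈ W then p k else 1 - p k) * ∑ i, a i - (∏ k, if k ∈ W then p k else 1 - p k) * ∑ i ∈ W, a i :=
      fun W => by ring
    rw [Finset.sum_congr rfl fun W _ => e W, Finset.sum_sub_distrib, ← Finset.sum_mul, sum_bernoulliWeight,
      sum_bernoulliWeight_mul_count, one_mul]
  rw [hrhs, ← Finset.sum_filter_add_sum_filter_not (Finset.univ : Finset (Finset ι)) (fun W => ∑ i ∈ W, a i ≤ j), Finset.mul_sum]
  have h1 : ∑ W ∈ (Finset.univ : Finset (Finset ι)).filter (fun W => ∑ i ∈ W, a i ≤ j),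
      (∑ i, a i - j) * (∏ k, if k ∈ W then p k else 1 - p k) ≤
      ∑ W ∈ (Finset.univ : Finset (Finset ι)).filter (fun W => ∑ i ∈ W, a i ≤ j),
      (∏ k, if k ∈ W then p k else 1 - p k) * (∑ i, a i - ∑ i ∈ W, a i) := by
    refine Finset.sum_le_sum fun W hW => ?_
    rw [Finset.mem_filter] at hW
    rw [mul_comm]
    exact mul_le_mul_of_nonneg_left (by linarith [hW.2]) (hw0 W)
  have h2 : 0 ≤ ∑ W ∈ (Finset.univ : Finset (Finset ι)).filter (fun W => ¬ (∑ i ∈ W, a i ≤ j)),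
      (∏ k, if k ∈ W then p k else 1 - p k) * (∑ i, a i - ∑ i ∈ W, a i) :=
    Finset.sum_nonneg fun W _ => mul_nonneg (hw0 W) (by linarith [hsub W])
  linarith

/-- **The floor-resolved block-star row, MARKOV HALF (every floor).**  Gates `0 ≤ p i ≤ 1`, weights `a i ≥ 0`, a floor
`q ≥ 0`, a real level `j`; if the total weight is at most `2j` and `(1 + q)·j < EW = ∑ a i p i`, then `P(W ≤ j) ≤ 1 − q`
(these hypotheses force `j > 0` and `q < 1`).  (`(∑ a − j)·P(W ≤ j) ≤ ∑ a − EW < ∑ a − (1+q) j ≤ (1 − q)(∑ a − j)`, the last step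
being `q·∑ a ≤ 2q·j`.)  Contains the two-block extremal family of `LawDec.treeBuiltRowFloor_threshold_sharp` (`∑ a = 2j`), so
`(1 + q)·j` is sharp here. [this work] -/
theorem floorRow_markov (p a : ι → ℝ) (hp0 : ∀ i, 0 ≤ p i) (hp1 : ∀ i, p i ≤ 1) (ha : ∀ i, 0 ≤ a i)
    (q j : ℝ) (hq0 : 0 ≤ q) (hA : ∑ i, a i ≤ 2 * j) (hj : (1 + q) * j < ∑ i, a i * p i) :
    ∑ W ∈ (Finset.univ : Finset (Finset ι)).filter (fun W => ∑ i ∈ W, a i ≤ j),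
      (∏ k, if k ∈ W then p k else 1 - p k) ≤ 1 - q := by
  set L := ∑ W ∈ (Finset.univ : Finset (Finset ι)).filter (fun W => ∑ i ∈ W, a i ≤ j),
      (∏ k, if k ∈ W then p k else 1 - p k) with hL
  have hmark := sum_sub_level_mul_smallBall_le p a hp0 hp1 ha j
  have hmA : ∑ i, a i * p i ≤ ∑ i, a i := Finset.sum_le_sum fun i _ => by nlinarith [ha i, hp1 i]
  -- `∑ a − j > 0`
  have hAj : 0 < ∑ i, a i - j := by
    by_cases hj0 : 0 ≤ j
    · nlinarith
    · linarith [Finset.sum_nonneg fun i (_ : i ∈ (Finset.univ : Finset ι)) => ha i]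
  -- `∑ a − (1+q) j ≤ (1 − q)(∑ a − j)` iff `q ∑ a ≤ 2 q j`
  have hkey : (∑ i, a i - j) * L < (1 - q) * (∑ i, a i - j) := by
    have : q * ∑ i, a i ≤ q * (2 * j) := mul_le_mul_of_nonneg_left hA hq0
    nlinarith
  by_contra hcon
  push Not at hcon
  nlinarith

/-- **THE FLOOR-RESOLVED BLOCK-STAR ROW AT HEAVY FLOORS.**  Gates `p k ≤ 1` and weights `a k ≥ 0` indexed by a finite type,
a least reliable gate `y` (`p y ≤ p k` for all `k`) with `1/2 ≤ p y`, and a real level `j` with `(1 + p y)·j < EW = ∑ a k p k`: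
then `P(W ≤ j) = ∑_{s : a(s) ≤ j} ∏_k (p k if k ∈ s else 1 − p k) ≤ 1 − p y`.  This is typer g36's `LawDec.TreeBuiltRowFloor`
(threshold `(1 + x)·j`, sharp at every floor) for depth-one block-stars at heavy floors; the lane's `far_indepBlob_min` needs
`2j < EW`.  Proof: `∑ a ≤ 2j` — `floorRow_markov`; `∑ a > 2j` — the lane's mass row `IndepBlob.massRow` (census-1 g14; Hall–Harris
transport, all gates `≥ 1/2`, no mean hypothesis). [this work] -/
theorem floorRow_indepBlob_min_heavy (p a : ι → ℝ) (hp1 : ∀ k, p k ≤ 1) (ha : ∀ k, 0 ≤ a k)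
    (y : ι) (hy : ∀ k, p y ≤ p k) (hhalf : 1 / 2 ≤ p y) (j : ℝ) (hj : (1 + p y) * j < ∑ k, a k * p k) :
    ∑ s ∈ (Finset.univ : Finset (Finset ι)).filter (fun s => ∑ k ∈ s, a k ≤ j),
      (∏ k, if k ∈ s then p k else 1 - p k) ≤ 1 - p y := by
  have hp0 : ∀ k, 0 ≤ p k := fun k => le_trans (by linarith) (hy k)
  by_cases hA : ∑ k, a k ≤ 2 * j
  · exact floorRow_markov p a hp0 hp1 ha (p y) j (hp0 y) hA hj
  · exact massRow p a (p y) hhalf (hp1 y) hy hp1 ha j (lt_of_not_ge hA)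

/-- **Every floor, total weight at most `2j`, least gate as the floor** (restating `floorRow_markov` in the one-type vocabulary of
`far_indepBlob_min`): `(1 + p y)·j < EW ⟹ P(W ≤ j) ≤ 1 − p y` whenever `∑ a ≤ 2j`, for ANY gate `y`. [this work] -/
theorem floorRow_indepBlob_of_sum_le (p a : ι → ℝ) (hp0 : ∀ k, 0 ≤ p k) (hp1 : ∀ k, p k ≤ 1) (ha : ∀ k, 0 ≤ a k)
    (y : ι) (j : ℝ) (hA : ∑ k, a k ≤ 2 * j) (hj : (1 + p y) * j < ∑ k, a k * p k) :
    ∑ s ∈ (Finset.univ : Finset (Finset ι)).filter (fun s => ∑ k ∈ s, a k ≤ j),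
      (∏ k, if k ∈ s then p k else 1 - p k) ≤ 1 - p y :=
  floorRow_markov p a hp0 hp1 ha (p y) j (hp0 y) hA hj

end IndepBlob

end Quant

end Summit.CriticalPhenomena.PercolationContinuityZ3.Theorems
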